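import Summits.BirchSwinnertonDyer.BirchSwinnertonDyer.Theorems.QuadraticBranchSignedControlEtaTransportLocalModelChange
import Literature.NumberTheory.GaloisRepresentations.PadicAlgebraDegreeOnePlace
import Mathlib.NumberTheory.Padics.HeightOneSpectrum
import HarnessLib

/-!
# MODEL TRANSPORT of a plus Honda system: the four clauses (L) (TR) (GEN) (GEN₀) of HONDA⁺@2 move along an isomorphism of
# models `E₁ → E₂` of the completion, in particular from Mathlib's `ℚ_[p]` (where the formal-group construction lives) to
# the adic model `v.adicCompletion ℚ` (where the stub `stub_plusHondaSystemTwo` of K4 `SignedControlAtTwo` is stated)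
# (stmt-BirchSwinnertonDyer-20309, line `eulerchar` v6; typing prerequisite of HONDA⁺@2, part III)

Route `ThetaPartnerAtTwo` (TP2; crux shared with `ResidualThetaTransportAtTwo`), crux K4, line `eulerchar` v6 (lead
`prover-bsd-wall-tp2-p3` g2); seat `prover-bsd-wall-tp2-p3-w2` (width seat 2/3, g2). Parts I–II: `…PlusLayerTwo`,
`…PlusLayerTwoPoints` (the `ℤ₂`-layers at `2` in the `zeta`/`stab` currency of the O10 local series, model `ℚ_[2]`).

WHY. `stub_plusHondaSystemTwo` asks for `d : ℕ → localPoints W (v.adicCompletion ℚ)` with (L) `d m ∈ E(ℚ_{2,m}·ℚ_v)`,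
(TR) `Tr_{m+2/m+1} d_{m+2} = −d_m`, (GEN) generation of `E(ℚ_{2,m}·ℚ_v)` by the `Γ_{ℚ_v}`-orbit of `d_m` modulo
`E(ℚ_{2,m−1}·ℚ_v) + 2E(ℚ_{2,m}·ℚ_v)`, (GEN₀) generation of `E(ℚ_v)` by `d_0` modulo `2`, all through the CHOSEN embedding
`closureEmb ℚ_v : ℚ̄ → ℚ̄_v`. The construction (lead's memo LAGPLUS-AT-2-CONSTRUCTION; K3 lead's `…SignedKatoUpToAtTwoLocal*`;
parts I–II) is carried out over Mathlib's `ℚ̄₂ = AlgebraicClosure ℚ_[2]`. This file moves the finished system from one model to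
the other, using x1b's model-transport data (`LocalModelTransportH1/Kummer/Tower`: `j = absClosureEmbedding E₁ E₂`,
`J = Point.map j`, `r = absGaloisRestrict E₁ E₂`, comparison element `τ` with `ι_{E₂} ∘ τ = j ∘ ι_{E₁}`) and the layer /
trace transport of `…QuadraticBranchSignedControlEtaTransportLocalModelChange` (`map_mem_localLayerPointsOfEmb_iff`,
`map_localTraceOfEmb_eq`).

WHAT (THEOREMS ONLY):
* §1 (any `K`, `κ`, `W`, isomorphic models `E₁ → E₂`) `map_closure_range_smul` — `J` maps the subgroup generated by the
  `Γ_{E₁}`-orbit of `d` onto the subgroup generated by the `Γ_{E₂}`-orbit of `J d`; **`plusHondaClauses_map`** — the four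
  clauses for `d` at `(E₁, closureEmb E₁)` imply the four clauses for `J ∘ d` at `(E₂, closureEmb E₂)`.
* §2 (`K = ℚ`, `E₁ = ℚ_[p]`, `E₂ = v.adicCompletion ℚ`, `v ∋ p`, Mathlib's `padicEquiv` read as an `Algebra` structure)
  **`exists_plusHonda_adicCompletion_of_padic`** — a plus Honda system at the model `ℚ_[p]` (for `closureEmb ℚ_[p]`) yields one
  at the adic model (for `closureEmb ℚ_v`), clauses VERBATIM those of `stub_plusHondaSystemTwo` with `2` replaced by `p`;
  `exists_plusHonda_adicCompletion_of_forall_padic` — the same from a system for EVERY `ι : ℚ̄ → ℚ̄_p` (the form in which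
  the `ℚ_[p]`-side files are written).

HONEST FRAMING: THEOREMS ONLY (no definition, no named fact, no instance — the `Algebra ℚ_[p] ℚ_v` structure is a local
`letI` inside one proof —, no `sorry`), route-independent (no `Theses` import); bookkeeping, closes no item; BSD is not proved
by any of this.

References: [Kobayashi2003] S. Kobayashi, Invent. Math. 152 (2003), Def. 1.1 (p. 2: "`F_{n,p}` is the completion of `F_n` at
the place over `p`"), §8.4; [SerreGaloisCohomology1997] II.§1.1 (restriction along embeddings of separable closures);
[MilneFT2022] Ch. 6–7 (algebraic closures unique up to isomorphism).
-/

set_option autoImplicit false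
-- the Theorems namespace of this sub repeats the summit name by design (D-0017 nested layout)
set_option linter.dupNamespace false

noncomputable section

open scoped Classical NumberField


namespace Summit.BirchSwinnertonDyer.BirchSwinnertonDyer.Theorems.SignedEC.PlusLayer

open Field WeierstrassCurve NumberField IsDedekindDomain Literature.NumberTheory.EllipticCurves
  Literature.NumberTheory.GaloisRepresentations Literature.NumberTheory.EllipticCurves.Kobayashi2003
  Summit.BirchSwinnertonDyer.Rank1Residual.Additive

/-! ## §1 Transport of the four clauses along isomorphic models `E₁ → E₂` -/

section Models

variable {K : Type} [Field K] (W : WeierstrassCurve K) {p : ℕ} [Fact p.Prime] (κ : ZpExtension K p)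
  (E₁ E₂ : Type) [Field E₁] [Field E₂] [Algebra K E₁] [Algebra K E₂] [Algebra E₁ E₂] [IsScalarTower K E₁ E₂]
  [Algebra.IsAlgebraic E₁ E₂]

/-- **`J` carries the subgroup generated by the `Γ_{E₁}`-orbit of `d` onto the subgroup generated by the `Γ_{E₂}`-orbit of
`J d`** (isomorphic models: `J(r σ • d) = σ • J d` with `r : Γ_{E₂} → Γ_{E₁}` onto). [cite: SerreGaloisCohomology1997, II.§1.1] -/
theorem map_closure_range_smul (hs : Function.Surjective (algebraMap E₁ E₂)) (d : localPoints W E₁) :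
    (AddSubgroup.closure (Set.range fun σ : absoluteGaloisGroup E₁ ↦ σ • d)).map
        (show localPoints W E₁ →+ localPoints W E₂ from
          Affine.Point.map (W' := W) ((absClosureEmbedding E₁ E₂).restrictScalars K)) =
      AddSubgroup.closure (Set.range fun σ : absoluteGaloisGroup E₂ ↦
        σ • (show localPoints W E₁ →+ localPoints W E₂ from
          Affine.Point.map (W' := W) ((absClosureEmbedding E₁ E₂).restrictScalars K)) d) := by
  set J : localPoints W E₁ →+ localPoints W E₂ :=
    (show localPoints W E₁ →+ localPoints W E₂ from
      Affine.Point.map (W' := W) ((absClosureEmbedding E₁ E₂).restrictScalars K)) with hJ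
  have hJs : ∀ (σ : absoluteGaloisGroup E₂) (R : localPoints W E₁),
      J (absGaloisRestrict E₁ E₂ σ • R) = σ • J R := fun σ R => by
    rw [localPoints.smul_def W E₂ σ (J R)]
    exact LocalModelTransport.map_smul_localPoints W E₁ E₂ σ R
  rw [AddMonoidHom.map_closure]
  congr 1
  ext Q
  constructor
  · rintro ⟨_, ⟨σ₁, rfl⟩, rfl⟩
    obtain ⟨σ₂, rfl⟩ := LocalModelTransport.absGaloisRestrict_surjective_of_surjective E₁ E₂ hs σ₁
    exact ⟨σ₂, (hJs σ₂ d).symm⟩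
  · rintro ⟨σ₂, rfl⟩
    exact ⟨_, ⟨absGaloisRestrict E₁ E₂ σ₂, rfl⟩, hJs σ₂ d⟩

/-- **The four clauses of a plus Honda system move along isomorphic models `E₁ → E₂`.** For `d : ℕ → E(Ē₁)` with
(L) `d m ∈ E(K_m·E₁)`, (TR) `Tr_{m+2/m+1} d_{m+2} = −d_m`, (GEN) every `P ∈ E(K_m·E₁)` (`m ≥ 1`) is `B + P' + p•R` with `B` in the
subgroup generated by the `Γ_{E₁}`-orbit of `d_m`, `P' ∈ E(K_{m−1}·E₁)`, `R ∈ E(K_m·E₁)`, and (GEN₀) every `P ∈ E(E₁)` is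
`a•d_0 + p•R`, the family `J ∘ d` satisfies the same four clauses at `E₂` (for the chosen embeddings `closureEmb E₁`, `closureEmb E₂`;
layer points and traces correspond by `map_mem_localLayerPointsOfEmb_iff` / `map_localTraceOfEmb_eq`, `J` is a bijection).
[cite: Kobayashi2003, Def. 1.1 (p. 2), §8.4] [cite: SerreGaloisCohomology1997, II.§1.1] -/
theorem plusHondaClauses_map (hs : Function.Surjective (algebraMap E₁ E₂)) (q : ℕ) {d : ℕ → localPoints W E₁}
    (hL : ∀ m, d m ∈ localLayerPointsOfEmb κ (closureEmb (K := K) E₁) W m)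
    (hTR : ∀ m, localTraceOfEmb κ (closureEmb (K := K) E₁) W (m + 1) (m + 2) (d (m + 2)) = -d m)
    (hGEN : ∀ m : ℕ, 1 ≤ m → ∀ P ∈ localLayerPointsOfEmb κ (closureEmb (K := K) E₁) W m,
      ∃ B ∈ AddSubgroup.closure (Set.range fun σ : absoluteGaloisGroup E₁ ↦ σ • d m),
        ∃ P' ∈ localLayerPointsOfEmb κ (closureEmb (K := K) E₁) W (m - 1),
        ∃ R ∈ localLayerPointsOfEmb κ (closureEmb (K := K) E₁) W m, P = B + P' + q • R)
    (hGEN0 : ∀ P ∈ localLayerPointsOfEmb κ (closureEmb (K := K) E₁) W 0,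
      ∃ a : ℤ, ∃ R ∈ localLayerPointsOfEmb κ (closureEmb (K := K) E₁) W 0, P = a • d 0 + q • R) :
    (∀ m, (show localPoints W E₁ →+ localPoints W E₂ from
        Affine.Point.map (W' := W) ((absClosureEmbedding E₁ E₂).restrictScalars K)) (d m) ∈
        localLayerPointsOfEmb κ (closureEmb (K := K) E₂) W m) ∧
    (∀ m, localTraceOfEmb κ (closureEmb (K := K) E₂) W (m + 1) (m + 2)
        ((show localPoints W E₁ →+ localPoints W E₂ from
          Affine.Point.map (W' := W) ((absClosureEmbedding E₁ E₂).restrictScalars K)) (d (m + 2))) =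
      -(show localPoints W E₁ →+ localPoints W E₂ from
          Affine.Point.map (W' := W) ((absClosureEmbedding E₁ E₂).restrictScalars K)) (d m)) ∧
    (∀ m : ℕ, 1 ≤ m → ∀ P ∈ localLayerPointsOfEmb κ (closureEmb (K := K) E₂) W m,
      ∃ B ∈ AddSubgroup.closure (Set.range fun σ : absoluteGaloisGroup E₂ ↦
          σ • (show localPoints W E₁ →+ localPoints W E₂ from
            Affine.Point.map (W' := W) ((absClosureEmbedding E₁ E₂).restrictScalars K)) (d m)),
        ∃ P' ∈ localLayerPointsOfEmb κ (closureEmb (K := K) E₂) W (m - 1),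
        ∃ R ∈ localLayerPointsOfEmb κ (closureEmb (K := K) E₂) W m, P = B + P' + q • R) ∧
    (∀ P ∈ localLayerPointsOfEmb κ (closureEmb (K := K) E₂) W 0,
      ∃ a : ℤ, ∃ R ∈ localLayerPointsOfEmb κ (closureEmb (K := K) E₂) W 0,
        P = a • (show localPoints W E₁ →+ localPoints W E₂ from
            Affine.Point.map (W' := W) ((absClosureEmbedding E₁ E₂).restrictScalars K)) (d 0) + q • R) := by
  obtain ⟨τ, hτ⟩ := LocalModelTransport.exists_smul_absClosureEmbedding_eq K E₁ E₂
  set J : localPoints W E₁ →+ localPoints W E₂ :=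
    (show localPoints W E₁ →+ localPoints W E₂ from
      Affine.Point.map (W' := W) ((absClosureEmbedding E₁ E₂).restrictScalars K)) with hJ
  have hmem : ∀ (n : ℕ) (Q : localPoints W E₁), J Q ∈ localLayerPointsOfEmb κ (closureEmb (K := K) E₂) W n ↔
      Q ∈ localLayerPointsOfEmb κ (closureEmb (K := K) E₁) W n :=
    fun n Q ↦ map_mem_localLayerPointsOfEmb_iff W κ E₁ E₂ hs hτ n Q
  have hsurj : ∀ P : localPoints W E₂, ∃ Q : localPoints W E₁, J Q = P :=
    fun P ↦ LocalModelTransport.exists_map_eq_localPoints W E₁ E₂ P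
  refine ⟨fun m ↦ (hmem m _).mpr (hL m), fun m ↦ ?_, fun m hm P hP ↦ ?_, fun P hP ↦ ?_⟩
  · -- (TR)
    rw [map_localTraceOfEmb_eq W κ E₁ E₂ hs hτ (m + 1) (m + 2) (hL (m + 2)), hTR m, map_neg]
  · -- (GEN)
    obtain ⟨Q, rfl⟩ := hsurj P
    obtain ⟨B, hB, P', hP', R, hR, hQ⟩ := hGEN m hm Q ((hmem m Q).mp hP)
    refine ⟨J B, ?_, J P', (hmem _ _).mpr hP', J R, (hmem _ _).mpr hR, ?_⟩
    · rw [← map_closure_range_smul W E₁ E₂ hs (d m)]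
      exact AddSubgroup.mem_map_of_mem J hB
    · rw [hQ, map_add, map_add, map_nsmul]
  · -- (GEN₀)
    obtain ⟨Q, rfl⟩ := hsurj P
    obtain ⟨a, R, hR, hQ⟩ := hGEN0 Q ((hmem 0 Q).mp hP)
    refine ⟨a, J R, (hmem _ _).mpr hR, ?_⟩
    rw [hQ, map_add, map_zsmul, map_nsmul]

end Models

/-! ## §2 The instance `ℚ_[p] → v.adicCompletion ℚ` (Mathlib's `padicEquiv`) -/

section Padic

variable (W : WeierstrassCurve ℚ) {p : ℕ} [Fact p.Prime] (κ : ZpExtension ℚ p)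

/-- **A plus Honda system at Mathlib's model `ℚ_[p]` (embedding `closureEmb ℚ_[p]`) yields one at the adic model `ℚ_v`, `v ∋ p`
(embedding `closureEmb ℚ_v`)** — the four clauses of `stub_plusHondaSystemTwo` (`p = 2`) VERBATIM on the target side. The
isomorphism `padicEquiv v : ℚ_v ≃ ℚ_[p]` is read backwards as an `Algebra ℚ_[p] ℚ_v` structure (surjective, scalar tower over `ℚ`,
algebraic) and §1 is applied. [cite: Kobayashi2003, Def. 1.1 (p. 2) ("F_{n,p} is the completion of F_n at the place over p")]
[cite: SerreGaloisCohomology1997, II.§1.1] -/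
theorem exists_plusHonda_adicCompletion_of_padic (v : HeightOneSpectrum (𝓞 ℚ)) (hv : (p : 𝓞 ℚ) ∈ v.asIdeal)
    (h : ∃ d : ℕ → localPoints W ℚ_[p],
      (∀ m, d m ∈ localLayerPointsOfEmb κ (closureEmb (K := ℚ) ℚ_[p]) W m) ∧
      (∀ m, localTraceOfEmb κ (closureEmb (K := ℚ) ℚ_[p]) W (m + 1) (m + 2) (d (m + 2)) = -d m) ∧
      (∀ m : ℕ, 1 ≤ m → ∀ P ∈ localLayerPointsOfEmb κ (closureEmb (K := ℚ) ℚ_[p]) W m,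
        ∃ B ∈ AddSubgroup.closure (Set.range fun σ : absoluteGaloisGroup ℚ_[p] ↦ σ • d m),
          ∃ P' ∈ localLayerPointsOfEmb κ (closureEmb (K := ℚ) ℚ_[p]) W (m - 1),
          ∃ R ∈ localLayerPointsOfEmb κ (closureEmb (K := ℚ) ℚ_[p]) W m, P = B + P' + p • R) ∧
      (∀ P ∈ localLayerPointsOfEmb κ (closureEmb (K := ℚ) ℚ_[p]) W 0,
        ∃ a : ℤ, ∃ R ∈ localLayerPointsOfEmb κ (closureEmb (K := ℚ) ℚ_[p]) W 0, P = a • d 0 + p • R)) :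
    ∃ d : ℕ → localPoints W (v.adicCompletion ℚ),
      (∀ m, d m ∈ localLayerPointsOfEmb κ (closureEmb (K := ℚ) (v.adicCompletion ℚ)) W m) ∧
      (∀ m, localTraceOfEmb κ (closureEmb (K := ℚ) (v.adicCompletion ℚ)) W (m + 1) (m + 2) (d (m + 2)) = -d m) ∧
      (∀ m : ℕ, 1 ≤ m → ∀ P ∈ localLayerPointsOfEmb κ (closureEmb (K := ℚ) (v.adicCompletion ℚ)) W m,
        ∃ B ∈ AddSubgroup.closure (Set.range fun σ : absoluteGaloisGroup (v.adicCompletion ℚ) ↦ σ • d m),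
          ∃ P' ∈ localLayerPointsOfEmb κ (closureEmb (K := ℚ) (v.adicCompletion ℚ)) W (m - 1),
          ∃ R ∈ localLayerPointsOfEmb κ (closureEmb (K := ℚ) (v.adicCompletion ℚ)) W m, P = B + P' + p • R) ∧
      (∀ P ∈ localLayerPointsOfEmb κ (closureEmb (K := ℚ) (v.adicCompletion ℚ)) W 0,
        ∃ a : ℤ, ∃ R ∈ localLayerPointsOfEmb κ (closureEmb (K := ℚ) (v.adicCompletion ℚ)) W 0,
          P = a • d 0 + p • R) := by
  have hpeq := (LocalField.primesEquiv_eq_of_natCast_mem p v (by exact_mod_cast hv)).symm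
  subst hpeq
  let e := Rat.HeightOneSpectrum.adicCompletion.padicEquiv (R := 𝓞 ℚ) v
  letI : Algebra ℚ_[((Rat.HeightOneSpectrum.primesEquiv v : Nat.Primes) : ℕ)] (v.adicCompletion ℚ) :=
    (e.symm.toAlgEquiv : _ →ₐ[ℚ] v.adicCompletion ℚ).toRingHom.toAlgebra
  have halg : ∀ x : ℚ_[((Rat.HeightOneSpectrum.primesEquiv v : Nat.Primes) : ℕ)],
      algebraMap ℚ_[((Rat.HeightOneSpectrum.primesEquiv v : Nat.Primes) : ℕ)] (v.adicCompletion ℚ) x = e.symm x :=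
    fun x => rfl
  haveI : IsScalarTower ℚ ℚ_[((Rat.HeightOneSpectrum.primesEquiv v : Nat.Primes) : ℕ)] (v.adicCompletion ℚ) :=
    IsScalarTower.of_algebraMap_eq fun x => by
      rw [halg]; exact ((e.symm.toAlgEquiv).commutes x).symm
  have hs : Function.Surjective
      (algebraMap ℚ_[((Rat.HeightOneSpectrum.primesEquiv v : Nat.Primes) : ℕ)] (v.adicCompletion ℚ)) :=
    fun y => ⟨e y, by rw [halg]; exact e.symm_apply_apply y⟩
  haveI : Algebra.IsAlgebraic ℚ_[((Rat.HeightOneSpectrum.primesEquiv v : Nat.Primes) : ℕ)] (v.adicCompletion ℚ) :=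
    ⟨fun y => by obtain ⟨x, rfl⟩ := hs y; exact isAlgebraic_algebraMap x⟩
  obtain ⟨d, hL, hTR, hGEN, hGEN0⟩ := h
  obtain ⟨h1, h2, h3, h4⟩ := plusHondaClauses_map W κ _ (v.adicCompletion ℚ) hs _ hL hTR hGEN hGEN0
  exact ⟨_, h1, h2, h3, h4⟩

/-- **The same from a system for EVERY embedding `ι : ℚ̄ → ℚ̄_p`** (the form in which the `ℚ_[p]`-side files are written:
`∀ ι, ∃ d, …`); specialise to `ι = closureEmb ℚ_[p]` and transport. [cite: Kobayashi2003, Def. 1.1 (p. 2), §8.4] -/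
theorem exists_plusHonda_adicCompletion_of_forall_padic (v : HeightOneSpectrum (𝓞 ℚ)) (hv : (p : 𝓞 ℚ) ∈ v.asIdeal)
    (h : ∀ ι : AlgebraicClosure ℚ →ₐ[ℚ] AlgebraicClosure ℚ_[p], ∃ d : ℕ → localPoints W ℚ_[p],
      (∀ m, d m ∈ localLayerPointsOfEmb κ ι W m) ∧
      (∀ m, localTraceOfEmb κ ι W (m + 1) (m + 2) (d (m + 2)) = -d m) ∧
      (∀ m : ℕ, 1 ≤ m → ∀ P ∈ localLayerPointsOfEmb κ ι W m,
        ∃ B ∈ AddSubgroup.closure (Set.range fun σ : absoluteGaloisGroup ℚ_[p] ↦ σ • d m),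
          ∃ P' ∈ localLayerPointsOfEmb κ ι W (m - 1), ∃ R ∈ localLayerPointsOfEmb κ ι W m, P = B + P' + p • R) ∧
      (∀ P ∈ localLayerPointsOfEmb κ ι W 0, ∃ a : ℤ, ∃ R ∈ localLayerPointsOfEmb κ ι W 0, P = a • d 0 + p • R)) :
    ∃ d : ℕ → localPoints W (v.adicCompletion ℚ),
      (∀ m, d m ∈ localLayerPointsOfEmb κ (closureEmb (K := ℚ) (v.adicCompletion ℚ)) W m) ∧
      (∀ m, localTraceOfEmb κ (closureEmb (K := ℚ) (v.adicCompletion ℚ)) W (m + 1) (m + 2) (d (m + 2)) = -d m) ∧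
      (∀ m : ℕ, 1 ≤ m → ∀ P ∈ localLayerPointsOfEmb κ (closureEmb (K := ℚ) (v.adicCompletion ℚ)) W m,
        ∃ B ∈ AddSubgroup.closure (Set.range fun σ : absoluteGaloisGroup (v.adicCompletion ℚ) ↦ σ • d m),
          ∃ P' ∈ localLayerPointsOfEmb κ (closureEmb (K := ℚ) (v.adicCompletion ℚ)) W (m - 1),
          ∃ R ∈ localLayerPointsOfEmb κ (closureEmb (K := ℚ) (v.adicCompletion ℚ)) W m, P = B + P' + p • R) ∧
      (∀ P ∈ localLayerPointsOfEmb κ (closureEmb (K := ℚ) (v.adicCompletion ℚ)) W 0,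
        ∃ a : ℤ, ∃ R ∈ localLayerPointsOfEmb κ (closureEmb (K := ℚ) (v.adicCompletion ℚ)) W 0,
          P = a • d 0 + p • R) :=
  exists_plusHonda_adicCompletion_of_padic W κ v hv (h (closureEmb (K := ℚ) ℚ_[p]))

end Padic

end Summit.BirchSwinnertonDyer.BirchSwinnertonDyer.Theorems.SignedEC.PlusLayer

end
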